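import Summits.ResolutionOfSingularities.ResolutionOfSingularities.Theorems.FrobeniusClosingPatchingRelPerfectTwoPlanesChartZeroJq
import Summits.ResolutionOfSingularities.ResolutionOfSingularities.Theorems.FrobeniusClosingPatchingRelPerfectTwoPlanesPlaneJq
import Summits.ResolutionOfSingularities.ResolutionOfSingularities.Theorems.FrobeniusClosingPatchingRelPerfectTwoPlanesChartTwoJqIdeals
import HarnessLib

/-!
# Crux `PatchingRelPerfect` (stmt-ResolutionOfSingularities-16161), chain w52 — the rank-two member
# `f = x₀x₁ + x₂³`, `I = (f) + 𝔪⁴`: the core rung for the REPAIRED companion, modulo the charts `B₁`, `B₃`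

[OURS · L1 W5.2 · rung, CONDITIONAL ASSEMBLY] Companion `Q = 𝔪ᴺ · A · J_q′ · A₃ · A₄ · 𝔪` with
`A = (f) + x₀𝔪 + 𝔪³`, `J_q′ = J_q + 𝔪³`, `J_q = (x₀) + (x₁,x₂)(x₁,x₂,x₃) + (x₃³)` (the point avatar of the
design note NEXT-two-planes-cube.md, Addenda 8–11; adding `𝔪³` does not change any chart image and makes
`𝔪^{N+13} ≤ 𝔪ᴺ·A·J_q′·A₃·A₄` immediate), `A₃ = (f) + 𝔪³`, `A₄ = (f) + x₀𝔪² + 𝔪⁴`.  By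
`atomConclusion_of_pointBlowup_charts` the `AtomDimFourBlowupAt`-shaped conclusion for `I` reduces to the
four charts of `Bl_𝔪`; `B₀` (`…TwoPlanesSideZero`: `J_q′ B₀ = (u)`) and `B₂` (`…TwoPlanesPlaneJq`,
`…TwoPlanesChartTwoJqIdeals`: `J_q′ B₂ = (u)(u, e₀)`) are discharged here, `B₁` and `B₃` are hypotheses
(remaining pieces R1, R2 of Addendum 11).

* `map_chartBase_tpJq'_zero`, `map_chartBase_tpJq'_two`, `map_tpAllJq'_zero`, `map_tpAllJq'_two`;
* `isRegular_of_isBlowup_tpAllJq'_zero`, `isRegular_of_isBlowup_tpAllJq'_two` — charts `B₀`, `B₂` unconditional;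
* `pow_le_tpQ0'` — `𝔪^{N+13} ≤ 𝔪ᴺ·A·J_q′·A₃·A₄`;
* `coreRung_twoPlanesJq_of_charts` — the conditional core rung.

Nothing here is a statement of the manuscript under review.

## References

* The Stacks Project, Tags 080A, 080B. [StacksProject]
* U. Görtz, T. Wedhorn, *Algebraic Geometry I*, 2nd ed. 2020, Prop. 13.91 (2). [GortzWedhorn2020]
-/

-- `Summit.<Summit>.<Sub>.Theorems` with `Sub = Summit` (single-conjunct summit, D-0017)
set_option linter.dupNamespace false

noncomputable section

open CategoryTheory CategoryTheory.Limits AlgebraicGeometry Literature.AlgebraicGeometry.Resolution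
open IsLocalRing

namespace Summit.ResolutionOfSingularities.ResolutionOfSingularities.Theorems

namespace TwoPlanesRung

open ConeRung

universe u

section RungJq

variable {S : Type u} [CommRing S] [IsRegularLocalRing S] (x : Fin 4 → S)
  (hx : Ideal.span (Set.range x) = IsLocalRing.maximalIdeal S)
  (hd : (IsLocalRing.maximalIdeal S).spanFinrank = 4)

local notation3 (prettyPrint := false) "M" => Ideal.span (Set.range x)
local notation3 (prettyPrint := false) "fT" => x 0 * x 1 + x 2 ^ 3
local notation3 (prettyPrint := false) "tpA" => Ideal.span {x 0 * x 1 + x 2 ^ 3} ⊔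
  Ideal.span {x 0} * Ideal.span (Set.range x) ⊔ Ideal.span (Set.range x) ^ 3
local notation3 (prettyPrint := false) "tpJq" => Ideal.span {x 0} ⊔ Ideal.span {x 1, x 2} * Ideal.span {x 1, x 2, x 3} ⊔
  Ideal.span {x 3 ^ 3}
local notation3 (prettyPrint := false) "tpJq'" => (Ideal.span {x 0} ⊔ Ideal.span {x 1, x 2} * Ideal.span {x 1, x 2, x 3} ⊔
  Ideal.span {x 3 ^ 3}) ⊔ Ideal.span (Set.range x) ^ 3
local notation3 (prettyPrint := false) "tpA3" => Ideal.span {x 0 * x 1 + x 2 ^ 3} ⊔ Ideal.span (Set.range x) ^ 3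
local notation3 (prettyPrint := false) "tpA4" => Ideal.span {x 0 * x 1 + x 2 ^ 3} ⊔
  Ideal.span {x 0} * Ideal.span (Set.range x) ^ 2 ⊔ Ideal.span (Set.range x) ^ 4
local notation3 (prettyPrint := false) "tpI" => Ideal.span {x 0 * x 1 + x 2 ^ 3} ⊔ Ideal.span (Set.range x) ^ 4
/-- `B₂`-side notations of `…TwoPlanesPlaneJq` -/
local notation3 (prettyPrint := false) "U₂" => Ideal.span {chartBase x 2 (x 2)}
local notation3 (prettyPrint := false) "II₂" => Ideal.span (Set.range
  (Fin.cons (chartBase x 2 (x 2)) (fun _ : Fin 1 => chartGen x 2 0) : Fin 2 → chartRing x 2))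
local notation3 (prettyPrint := false) "J₂" => Ideal.span {chartGen x 2 0 * chartGen x 2 1, chartBase x 2 (x 2)} *
    (Ideal.span {chartGen x 2 0 * chartGen x 2 1 + chartBase x 2 (x 2) * chartGen x 2 2 ^ 3} ⊔
      Ideal.span {chartBase x 2 (x 2)} * Ideal.span {chartGen x 2 0} ⊔ Ideal.span {chartBase x 2 (x 2)} ^ 2) *
    (Ideal.span {chartGen x 2 0 * chartGen x 2 1 + chartBase x 2 (x 2) * chartGen x 2 2 ^ 3} ⊔
      Ideal.span {chartBase x 2 (x 2)} ^ 2)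
local notation3 (prettyPrint := false) "U₀" => Ideal.span {chartBase x 0 (x 0)}

omit [IsRegularLocalRing S] in
/-- `J_q′ B₀ = (u)`. [cite: StacksProject, Tag 080B] -/
theorem map_chartBase_tpJq'_zero : (tpJq').map (chartBase x 0) = U₀ := by
  rw [Ideal.map_sup, map_chartBase_tpJq_zero, Ideal.map_pow, ConeRung.map_chartBase_M]
  exact sup_eq_left.mpr (Ideal.pow_le_self (by norm_num))

omit [IsRegularLocalRing S] in
/-- `J_q′ B₂ = (u)(e₀, u)`. [cite: StacksProject, Tag 080B] -/
theorem map_chartBase_tpJq'_two :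
    (tpJq').map (chartBase x 2) = U₂ * Ideal.span {chartGen x 2 0, chartBase x 2 (x 2)} := by
  rw [Ideal.map_sup, map_chartBase_tpJq_two, Ideal.map_pow, ConeRung.map_chartBase_M]
  refine sup_eq_left.mpr ?_
  rw [pow_succ' (Ideal.span {chartBase x 2 (x 2)}) 2]
  exact Ideal.mul_mono_right ((Ideal.pow_le_self two_ne_zero).trans
    ((Ideal.span_singleton_le_iff_mem _).mpr (Ideal.subset_span (by simp))))

omit [IsRegularLocalRing S] in
/-- `𝔪ᴺ·A·J_q′·A₃·A₄·I ↦ (u)^{N+3}·(A₃A₄I)B₀` on `B₀`. [cite: StacksProject, Tag 080B] -/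
theorem map_tpAllJq'_zero (N : ℕ) :
    (M ^ N * tpA * tpJq' * tpA3 * tpA4 * tpI).map (chartBase x 0) =
      U₀ ^ (N + 3) * ((tpA3 * tpA4 * tpI).map (chartBase x 0)) := by
  rw [Ideal.map_mul, Ideal.map_mul, Ideal.map_mul, Ideal.map_mul, Ideal.map_mul, Ideal.map_pow,
    ConeRung.map_chartBase_M, map_tpA_zero, map_chartBase_tpJq'_zero, Ideal.map_mul, Ideal.map_mul]
  exact tp_allJq_product_zero _ _ _ _ N

omit [IsRegularLocalRing S] in
/-- `𝔪ᴺ·A·J_q′·A₃·A₄·I ↦ (u^{N+9})·((J₂(u,e₀))(u,e₀))` on `B₂`. [cite: StacksProject, Tag 080B] -/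
theorem map_tpAllJq'_two (N : ℕ) :
    (M ^ N * tpA * tpJq' * tpA3 * tpA4 * tpI).map (chartBase x 2) =
      Ideal.span {chartBase x 2 (x 2) ^ (N + 9)} * ((J₂ * II₂) * II₂) := by
  rw [Ideal.map_mul, Ideal.map_mul, Ideal.map_mul, Ideal.map_mul, Ideal.map_mul, Ideal.map_pow,
    ConeRung.map_chartBase_M, map_chartBase_tpA, map_chartBase_tpJq'_two, map_chartBase_tpA3,
    map_chartBase_tpA4, map_chartBase_tpI, span_range_plane, ← Ideal.span_singleton_pow]
  exact tp_allJq_product U₂ (Ideal.span {chartGen x 2 0, chartBase x 2 (x 2)}) _ _ _ N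

include hx hd in
/-- **Chart `B₀` for the repaired companion** (unconditional). [cite: StacksProject, Tag 080A] -/
theorem isRegular_of_isBlowup_tpAllJq'_zero (N : ℕ) {Y : Scheme.{u}} {ρ : Y ⟶ Spec (.of (chartRing x 0))}
    (hρ : IsBlowup ρ (affineBlowup.idealSheaf ((M ^ N * tpA * tpJq' * tpA3 * tpA4 * tpI).map (chartBase x 0)))) :
    Scheme.IsRegular Y := by
  rw [map_tpAllJq'_zero] at hρ
  exact isRegular_of_isBlowup_tpProd_zero x hx hd (N + 3) hρ

include hx hd in
/-- **Chart `B₂` for the repaired companion** (unconditional). [cite: StacksProject, Tag 080A] -/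
theorem isRegular_of_isBlowup_tpAllJq'_two (N : ℕ) {Y : Scheme.{u}} {ρ : Y ⟶ Spec (.of (chartRing x 2))}
    (hρ : IsBlowup ρ (affineBlowup.idealSheaf ((M ^ N * tpA * tpJq' * tpA3 * tpA4 * tpI).map (chartBase x 2)))) :
    Scheme.IsRegular Y := by
  rw [map_tpAllJq'_two] at hρ
  exact isRegular_of_isBlowup_tpPlane_coreJq_two x hx hd 2 rfl (N + 9) hρ

omit [IsRegularLocalRing S] in
/-- **`𝔪^{N+13} ≤ 𝔪ᴺ·A·J_q′·A₃·A₄`.** [folklore] -/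
theorem pow_le_tpQ0' (N : ℕ) : M ^ (N + 13) ≤ M ^ N * tpA * tpJq' * tpA3 * tpA4 := by
  rw [show N + 13 = N + 3 + 3 + 3 + 4 by ring, pow_add, pow_add, pow_add, pow_add]
  exact Ideal.mul_mono (Ideal.mul_mono (Ideal.mul_mono (Ideal.mul_mono le_rfl le_sup_right) le_sup_right)
    le_sup_right) le_sup_right

include hx hd in
/-- **CORE RUNG for the rank-two member with the repaired companion, modulo the charts `B₁`, `B₃`.**
If every blowing up of `Spec B₁` and of `Spec B₃` along the image of `𝔪ᴺ·A·J_q′·A₃·A₄·I` is regular,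
then every blowing up `T = Bl_I Spec S`, `I = (x₀x₁ + x₂³) + 𝔪⁴`, carries a non-zero ideal sheaf
cosupported in the closed fibre with regular blowing up.
[cite: StacksProject, Tag 080A] [cite: GortzWedhorn2020, Prop. 13.91 (2)] -/
theorem coreRung_twoPlanesJq_of_charts (N : ℕ)
    (h1 : ∀ (Y : Scheme.{u}) (ρ : Y ⟶ Spec (.of (chartRing x 1))),
      IsBlowup ρ (affineBlowup.idealSheaf ((M ^ N * tpA * tpJq' * tpA3 * tpA4 * tpI).map (chartBase x 1))) →
        Scheme.IsRegular Y)
    (h3 : ∀ (Y : Scheme.{u}) (ρ : Y ⟶ Spec (.of (chartRing x 3))),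
      IsBlowup ρ (affineBlowup.idealSheaf ((M ^ N * tpA * tpJq' * tpA3 * tpA4 * tpI).map (chartBase x 3))) →
        Scheme.IsRegular Y)
    (T : Scheme.{u}) (f : T ⟶ Spec (.of S))
    (hf : IsBlowup f (affineBlowup.idealSheaf (Ideal.span {fT} ⊔ IsLocalRing.maximalIdeal S ^ 4))) :
    ∃ (J : T.IdealSheafData) (T' : Scheme.{u}) (π : T' ⟶ T), J ≠ ⊥ ∧
      (∀ t : T, t ∈ J.support → f.base t = IsLocalRing.closedPoint S) ∧
      IsBlowup π J ∧ Scheme.IsRegular T' := by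
  haveI : IsDomain S := isDomain_of_isRegularLocalRing S
  have hx0 : x 0 ≠ 0 := (isRsopPart_comp_of_rsop hd x hx id Function.injective_id).ne_zero 0
  have h𝔪 : IsLocalRing.maximalIdeal S ≠ ⊥ := fun h => hx0 (by
    have := hx.le (Ideal.subset_span (Set.mem_range_self 0)); rw [h] at this
    exact (Submodule.mem_bot S).mp this)
  rw [← hx] at hf
  have hI : (tpI) ≠ ⊥ := fun h => pow_ne_zero 4 h𝔪 (by
    rw [← hx]; exact eq_bot_iff.mpr (le_sup_right.trans h.le))
  have hQ₀ : IsLocalRing.maximalIdeal S ^ (N + 13) ≤ M ^ N * tpA * tpJq' * tpA3 * tpA4 := by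
    rw [← hx]; exact pow_le_tpQ0' x N
  refine atomConclusion_of_pointBlowup_charts x hx h𝔪 hI hQ₀ (fun i Y ρ hρ => ?_) T f hf
  rw [mul_comm (tpI) (M ^ N * tpA * tpJq' * tpA3 * tpA4)] at hρ
  fin_cases i
  · exact isRegular_of_isBlowup_tpAllJq'_zero x hx hd N hρ
  · exact h1 Y ρ hρ
  · exact isRegular_of_isBlowup_tpAllJq'_two x hx hd N hρ
  · exact h3 Y ρ hρ

end RungJq

end TwoPlanesRung

end Summit.ResolutionOfSingularities.ResolutionOfSingularities.Theorems

end
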